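/-
Copyright (c) 2026 the pub-hodgecm-mathlib formalisation cell (harness21).  Prover seat hodgecm-mathlib-LH4-p16 (g0), req620 Track A «(D-RAM) FOUR-FRAME» squad
(STAGE-1b, row (2) of the piece `f_{T₊}`, the (β₂) road under heir LEAD F0P3a-plan (g21) T20-18∕T20-19 (R-36) «PURE-CELL LEDGER, RELATIVE SIGNS»; row (L-K) holder;
MECH-K0 v1 67ac68e4 ∕ MECH-D 16:0xZ), 2026-09-04.
-/
import Summits.HodgeConjecture.HodgeConjecture.Theorems.F0P3cDyRamDepthScalar       -- ★ p861454 (this seat): `normFormSet_eq_ray_of_small`, `ray_eq_valueSetMod_smul_xPlus`; brings ★ p861372 `herm_dualGenInv_mul_eq`, ★ DEFS `forall_mem_herm_iff_exists`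
import Summits.HodgeConjecture.HodgeConjecture.Theorems.F0P3cDyRamShellLineModel    -- ★ p861579 (this seat): `isOrd_one`, `isOrd_mul`
import HarnessLib

/-!
# Crux `H413`, line LH4 «(D-RAM) FOUR-FRAME» — STAGE-1b, row (2), the (β₂) road (R-36): «NEAR 1 EVERY CONE VERTEX IS RAY-DOMINATED» — if the depth multiplier factors as
# `μ = jE(ϖ^{m′})·μ̃` with `μ̃` in the order `𝒪_j` of the cell and `m′ ≥ m` (the thickening level), the norm-form letter of ★ p861372 HEAD B over `Λ = x₀·𝒪_j` (`Y = dualGen x₀ ∈ 𝒪_j`)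
# IS the thickened `a`-ray `valueSetMod σ ϖ m ((e₀·t₊⁻¹) • X₊)` — so the label of EVERY such vertex is the norm class of ONE scalar `e₀ = jE⁻¹Tr_ρ(μ·h·N_Θ(Y⁻¹x₀))`

Cell `hodgecm-mathlib` (D-0151), FLOOR 0, crux item H413 = `stmt-HodgeConjecture-24833`, route of record `HCCMUnconditional`; squad F0∕P3c∕LH4; lane
`--supports stmt-HodgeConjecture-24833 --as helper` (count-neutral; pays NO tier-0 row).  THEOREMS ONLY (no `def`, no instance, no notation, no `sorry`, default heartbeats);
★-only imports; states NO law.  DATUM-FREE M-letters of ★ DEFS `F0P3cDyRamToricCensusDefs` (`ρ`-datum letters `hρρ hvρ hα hα1 hint`, `Θ` an isometric involution commuting with `ρ`,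
order parameter `cc` with `ρ cc = cc`, `0 < |cc| ≤ 1`, form scalar `h ≠ 0` with `Θh = h`, generator `x₀ ≠ 0`, `Y = dualGen ρ Θ α cc h x₀`) + the embedding letters `hjv hΘj hjfix`.

WHY (MECH-K0 v1 §0–§1; MECH-D; LH4-p15 (g0) ψ(ν) reduction; heir LEAD T20-19).  After ★ p861311 ∘ p861372 the letter of the self-dual vertex over `Λ = x₀·𝒪_j` near `1` is the
`ϖ^m`-value set of `(ζ, a) ↦ Tr_ρ(c_Λ·N_Θ(Y ζ + jE a))`, `c_Λ = μ∕(cc(α − ρα)·ΘY)`, and ★ p861454 reads the label off the `a`-RAY `valueSetMod σ ϖ m ((e₀ t₊⁻¹) • X₊)` PROVIDED the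
`ζ`-terms are `ϖ^m`-small (`hsmall`).  THIS FILE DISCHARGES `hsmall` from three facts every cone cell near `1` has: (1) `Λ` is INTEGRAL, `Y ∈ 𝒪_j` (the `hyO` clause of `levelSet`);
(2) the depth multiplier `μ = lam − jE u₀₀` is DEEP: `μ = jE(ϖ^{m′})·μ̃` with `m ≤ m′` (`|lam − u₀₀| ≤ |ϖ^{m*}|` — the same nearness to `1` as the board's `hum`); (3) `μ̃ ∈ 𝒪_j`
(`lam − u₀₀` has conductor `jl ≥ m′ + j` — ★ T5c `hjl`; on the diagonal and specific cells this is `δ = jl − m ≥ j`).  KEY IDENTITY: `c_Λ·N_Θ(η) = h·Θ(Wη)·μ·(Wη)`, `W = Y⁻¹x₀`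
(★ p861372 `herm_dualGenInv_mul_eq`), so with `y := x₀ζ ∈ Λ` and `w := jE a·W ∈ Λ^♯` the `ζ`-part of the value is `Tr_ρ(hΘy·μy) + Tr_ρ(hΘy·μw) + Tr_ρ(hΘw·μy)` — three
hermitian pairings of a member of `Λ` with a member of `μ·Λ^♯ = jE(ϖ^{m′})·μ̃Λ^♯ ⊆ jE(ϖ^{m′})·Λ^♯`, each INTEGRAL by ★ DEFS `forall_mem_herm_iff_exists` (the dual of `x₀𝒪_j` is `Y⁻¹x₀𝒪_j`),
hence `ϖ^{m′}`-small, hence `ϖ^m`-small: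
* §1 `v_trace_herm_le_one_of_isOrd` (the integral pairing `Λ × Λ^♯ → 𝒪`), the swap ★ (K3) `herm_swap_eq` (`Tr_ρ(hΘw·y) = Θ Tr_ρ(hΘy·w)`, by name), `depthCoeff_mul_norm_eq` (the key identity),
  `zetaPart_eq` (the three-term split).
* §2 HEAD `hsmall_of_isOrd` — the `hsmall` hypothesis of ★ p861454 `normFormSet_eq_ray_of_small`, discharged; HEAD `normFormSet_eq_ray_of_isOrd` — THE LETTER IS THE RAY:
  `{z ∣ ∃ ζ a, IsOrd ζ ∧ |a| ≤ 1 ∧ |(jEϖ^m)⁻¹(jE z − Tr_ρ(c_Λ N_Θ(Yζ + jE a)))| ≤ 1} = valueSetMod σ ϖ m ((e₀·t₊⁻¹) • X₊)`, `jE e₀ = Tr_ρ(c_Λ)`.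
CONSEQUENCE (for the rows, with ★ p861454 §4): near `1`, on EVERY cone cell whose depth multiplier is `j`-integral (`μ̃ ∈ 𝒪_j`), `label(Λ) = ` norm class of `e₀(Λ)∕t₊` with
`e₀(Λ) = jE⁻¹(jE(ϖ^{m′})·Tr_ρ(μ̃·h·N_Θ(Y⁻¹x₀)))` — and `Tr_ρ(h·N_Θ(Y⁻¹x₀)) = jE⟨w₀, w₀⟩ = −jE(r_Λ·h_W·(ϖσϖ)^{−b})` is the GLUE UNIT's (★ T2b ∕ ★ p857402 `map_glueNorm_eq`): the label
is LOCKED to the glue-norm class up to the `μ̃`-digits — the mechanism of the pure cells (D, S₁, K₀) and of the cross-literal sign `ω(h_{W,2}∕h_{W,1})` (MECH-D), not proved here.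
HONEST LABEL.  Count-neutral lattice ∕ order algebra; nothing printed is asserted; no census law is stated; `HC_CM` is proved only modulo the 7 printed citations (2 remaining named
inputs: hLiu418 = `stmt-HodgeConjecture-24832`, h413 = `stmt-HodgeConjecture-24833`) until rung 0 closes.
## References
* [Jacobowitz1962] R. Jacobowitz, *Hermitian forms over local fields*, Amer. J. Math. 84 (1962): §4 (dual lattices; the pairing `Λ × Λ^♯ → 𝒪`).
* [Serre1979] J.-P. Serre, *Local Fields*, GTM 67 (1979): Ch. III §6 Prop. 12 (orders of conductor `c`), Ch. V §3 Cor. 3.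
* [Rogawski1990] J. D. Rogawski, *Automorphic Representations of Unitary Groups in Three Variables*, Ann. of Math. Stud. 123 (1990): §4.9 Prop. 4.9.1 (b) p. 55.
* [Kottwitz1986BaseChangeUnits] R. E. Kottwitz, *Base change for unit elements of Hecke algebras*, Compositio Math. 60 (1986): §1 pp. 240–241.
-/

set_option autoImplicit false

noncomputable section

namespace Summit.HodgeConjecture.HodgeConjecture.Cruxes.H413.F0P3cDyRamNormFormRayDominated

open scoped Valued WithZero Matrix MatrixGroups
open WithZero
open Literature.NumberTheory.Automorphic.UnitaryThreeFourFrame (IsRamifiedQuadraticDatum)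
open Summit.HodgeConjecture.HodgeConjecture.Cruxes.H413.F0P3cDyRamFourFramePieces
open Summit.HodgeConjecture.HodgeConjecture.Cruxes.H413.F0P3cDyRamToricCensusDefs
open Summit.HodgeConjecture.HodgeConjecture.Cruxes.H413.F0P3cDyRamDepthFormLineModel (herm_dualGenInv_mul_eq)
open Summit.HodgeConjecture.HodgeConjecture.Cruxes.H413.F0P3cDyRamConeLevelTransport (herm_swap_eq)
open Summit.HodgeConjecture.HodgeConjecture.Cruxes.H413.F0P3cDyRamDepthScalar (normFormSet_eq_ray_of_small)
open Summit.HodgeConjecture.HodgeConjecture.Cruxes.H413.F0P3cDyRamShellLineModel (isOrd_one isOrd_mul)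

variable {E : Type} {M : Type*} [Field E] [Valued E ℤᵐ⁰] [Field M] [Valued M ℤᵐ⁰] {ρ Θ : M →+* M} {α : M}

/-! ## §1 The integral pairing `Λ × Λ^♯ → 𝒪`, the swap, the key identity, the three-term split -/

/-- **THE PAIRING `Λ × Λ^♯ → 𝒪` IS INTEGRAL**: for `y = x₀·ζ ∈ Λ = x₀·𝒪_c` (`IsOrd ζ`) and `b = Y⁻¹x₀·z ∈ Λ^♯` (`IsOrd z`, `Y = dualGen x₀`),
`|h·Θy·b + ρ(h·Θy·b)| ≤ 1` (★ DEFS `forall_mem_herm_iff_exists`, direction `←`, at the member `y`). [cite: Jacobowitz1962, §4] -/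
theorem v_trace_herm_le_one_of_isOrd (hρρ : ∀ x, ρ (ρ x) = x) (hvρ : ∀ x, Valued.v (ρ x) = Valued.v x) (hα : ρ α ≠ α) (hα1 : Valued.v α ≤ 1)
    (hint : ∀ z : M, Valued.v z ≤ 1 → Valued.v ((z - ρ z) / (α - ρ α)) ≤ 1)
    (hΘΘ : ∀ x, Θ (Θ x) = x) (hΘρ : ∀ x, Θ (ρ x) = ρ (Θ x)) (hvΘ : ∀ x, Valued.v (Θ x) = Valued.v x)
    {cc : M} (hc : ρ cc = cc) (hc0 : cc ≠ 0) (hc1 : Valued.v cc ≤ 1) {hM : M} (hh : hM ≠ 0) {Λ : AddSubgroup M} {x₀ : M} (hx₀ : x₀ ≠ 0)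
    (hΛ : ∀ x, x ∈ Λ ↔ ∃ z, IsOrd ρ α cc z ∧ x = x₀ * z) {ζ z : M} (hζ : IsOrd ρ α cc ζ) (hz : IsOrd ρ α cc z) :
    Valued.v (hM * Θ (x₀ * ζ) * ((dualGen ρ Θ α cc hM x₀)⁻¹ * (x₀ * z)) + ρ (hM * Θ (x₀ * ζ) * ((dualGen ρ Θ α cc hM x₀)⁻¹ * (x₀ * z)))) ≤ 1 :=
  (forall_mem_herm_iff_exists hρρ hvρ hα hα1 hint hΘΘ hΘρ hvΘ hc hc0 hc1 hh hx₀ hΛ _).2 ⟨z, hz, rfl⟩ (x₀ * ζ) ((hΛ _).2 ⟨ζ, hζ, rfl⟩)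

omit [Valued E ℤᵐ⁰] [Valued M ℤᵐ⁰] in
/-- A `ρ`-fixed scalar comes out of the `ρ`-trace: `C·P + ρ(C·P) = C·(P + ρP)`. [cite: Jacobowitz1962, §4] -/
theorem trace_mul_fixed {C : M} (hC : ρ C = C) (P : M) : C * P + ρ (C * P) = C * (P + ρ P) := by
  rw [map_mul, hC]; ring

omit [Valued E ℤᵐ⁰] [Valued M ℤᵐ⁰] in
/-- **THE KEY IDENTITY `c_Λ·N_Θ(η) = h·Θ(Wη)·μ·(Wη)`**, `W = Y⁻¹x₀`, `c_Λ = μ∕(cc(α − ρα)·ΘY)` (★ p861372 `herm_dualGenInv_mul_eq`, rearranged). [cite: Jacobowitz1962, §4] -/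
theorem depthCoeff_mul_norm_eq (hΘΘ : ∀ x, Θ (Θ x) = x) {cc hM x₀ : M} (hcc : cc * (α - ρ α) ≠ 0) (hhM : hM ≠ 0) (hx₀ : x₀ ≠ 0) (μ η : M) :
    μ / (cc * (α - ρ α) * Θ (dualGen ρ Θ α cc hM x₀)) * (η * Θ η) =
      hM * Θ ((dualGen ρ Θ α cc hM x₀)⁻¹ * x₀ * η) * (μ * ((dualGen ρ Θ α cc hM x₀)⁻¹ * x₀ * η)) := by
  rw [herm_dualGenInv_mul_eq (ρ := ρ) hΘΘ hcc hhM hx₀ μ η, div_mul_eq_mul_div]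

omit [Valued E ℤᵐ⁰] [Valued M ℤᵐ⁰] in
/-- **THE THREE-TERM SPLIT OF THE `ζ`-PART**: with `y = x₀ζ`, `w = t·Y⁻¹x₀` (any scalar `t`; `Y ≠ 0`),
`hΘ(Y⁻¹x₀(Yζ + t))·μ(Y⁻¹x₀(Yζ + t)) − hΘ(Y⁻¹x₀(Y·0 + t))·μ(Y⁻¹x₀(Y·0 + t)) = hΘy·(μy) + hΘy·(μw) + hΘw·(μy)`. [cite: Jacobowitz1962, §4] -/
theorem zetaPart_eq {Y : M} (hY : Y ≠ 0) (hM x₀ μ ζ t : M) :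
    hM * Θ (Y⁻¹ * x₀ * (Y * ζ + t)) * (μ * (Y⁻¹ * x₀ * (Y * ζ + t))) - hM * Θ (Y⁻¹ * x₀ * (Y * 0 + t)) * (μ * (Y⁻¹ * x₀ * (Y * 0 + t))) =
      hM * Θ (x₀ * ζ) * (μ * (x₀ * ζ)) + hM * Θ (x₀ * ζ) * (μ * (Y⁻¹ * (x₀ * t))) + hM * Θ (Y⁻¹ * (x₀ * t)) * (μ * (x₀ * ζ)) := by
  have e1 : Y⁻¹ * x₀ * (Y * ζ + t) = x₀ * ζ + Y⁻¹ * (x₀ * t) := by field_simp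
  have e0 : Y⁻¹ * x₀ * (Y * 0 + t) = Y⁻¹ * (x₀ * t) := by ring
  rw [e1, e0, map_add]
  ring

/-! ## §2 HEADS — `hsmall` discharged; the letter is the ray -/

/-- **HEAD — `hsmall` OF ★ p861454 DISCHARGED NEAR 1.**  Frame: the `ρ`∕`Θ` letters of ★ DEFS, `cc` (`ρcc = cc`, `0 < |cc| ≤ 1`, `cc(α − ρα) ≠ 0`), `h ≠ 0` with `Θh = h`,
`x₀ ≠ 0` presenting `Λ = x₀·𝒪_cc`, `Y = dualGen ρ Θ α cc h x₀ ∈ 𝒪_cc` (INTEGRAL cell member), the embedding letters `|jE c| ≤ 1 ↔ |c| ≤ 1`, `Θ ∘ jE = jE ∘ σ`, `ρ` fixes `jE(E)`,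
`|ϖ| ≤ 1`; the depth multiplier `μ = jE(ϖ^{m′})·μ̃` with `μ̃ ∈ 𝒪_cc` and `m ≤ m′`.  THEN for all `ζ ∈ 𝒪_cc`, `|a| ≤ 1`:
`|(jEϖ^m)⁻¹·(Tr_ρ(c_Λ N_Θ(Yζ + jE a)) − Tr_ρ(c_Λ N_Θ(Y·0 + jE a)))| ≤ 1`, `c_Λ = μ∕(cc(α − ρα)·ΘY)`.
[cite: Jacobowitz1962, §4] [cite: Serre1979, Ch. III §6 Prop. 12] [cite: Kottwitz1986BaseChangeUnits, §1 pp. 240–241] -/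
theorem hsmall_of_isOrd (hρρ : ∀ x, ρ (ρ x) = x) (hvρ : ∀ x, Valued.v (ρ x) = Valued.v x) (hα : ρ α ≠ α) (hα1 : Valued.v α ≤ 1)
    (hint : ∀ z : M, Valued.v z ≤ 1 → Valued.v ((z - ρ z) / (α - ρ α)) ≤ 1)
    (hΘΘ : ∀ x, Θ (Θ x) = x) (hΘρ : ∀ x, Θ (ρ x) = ρ (Θ x)) (hvΘ : ∀ x, Valued.v (Θ x) = Valued.v x)
    {cc : M} (hc : ρ cc = cc) (hc0 : cc ≠ 0) (hc1 : Valued.v cc ≤ 1) (hcc : cc * (α - ρ α) ≠ 0) {hM : M} (hh : hM ≠ 0) (hΘh : Θ hM = hM)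
    {Λ : AddSubgroup M} {x₀ : M} (hx₀ : x₀ ≠ 0) (hΛ : ∀ x, x ∈ Λ ↔ ∃ z, IsOrd ρ α cc z ∧ x = x₀ * z)
    (hYO : IsOrd ρ α cc (dualGen ρ Θ α cc hM x₀))
    {σ : E →+* E} (jE : E →+* M) (hjv : ∀ c, Valued.v (jE c) ≤ 1 ↔ Valued.v c ≤ 1) (hΘj : ∀ x, Θ (jE x) = jE (σ x))
    (hjfix : ∀ z, ρ z = z ↔ ∃ c, jE c = z) {ϖ : E} (hϖ1 : Valued.v ϖ ≤ 1)
    {μ μt : M} {m m' : ℕ} (hμ : μ = jE (ϖ ^ m') * μt) (hμt : IsOrd ρ α cc μt) (hmm : m ≤ m') :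
    ∀ (ζ : M) (a : E), IsOrd ρ α cc ζ → Valued.v a ≤ 1 →
      Valued.v ((jE ϖ ^ m)⁻¹ *
        ((μ / (cc * (α - ρ α) * Θ (dualGen ρ Θ α cc hM x₀)) * ((dualGen ρ Θ α cc hM x₀ * ζ + jE a) * Θ (dualGen ρ Θ α cc hM x₀ * ζ + jE a)) +
            ρ (μ / (cc * (α - ρ α) * Θ (dualGen ρ Θ α cc hM x₀)) * ((dualGen ρ Θ α cc hM x₀ * ζ + jE a) * Θ (dualGen ρ Θ α cc hM x₀ * ζ + jE a)))) -
          (μ / (cc * (α - ρ α) * Θ (dualGen ρ Θ α cc hM x₀)) * ((dualGen ρ Θ α cc hM x₀ * 0 + jE a) * Θ (dualGen ρ Θ α cc hM x₀ * 0 + jE a)) +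
            ρ (μ / (cc * (α - ρ α) * Θ (dualGen ρ Θ α cc hM x₀)) * ((dualGen ρ Θ α cc hM x₀ * 0 + jE a) * Θ (dualGen ρ Θ α cc hM x₀ * 0 + jE a)))))) ≤ 1 := by
  intro ζ a hζ ha
  set Y : M := dualGen ρ Θ α cc hM x₀ with hYdef
  have hY0 : Y ≠ 0 := by
    rw [hYdef, dualGen_def]; exact mul_ne_zero (mul_ne_zero hh (mul_ne_zero hx₀ ((map_ne_zero Θ).2 hx₀))) hcc
  -- scalars through `jE`
  have hρj : ∀ c : E, ρ (jE c) = jE c := fun c => (hjfix _).2 ⟨c, rfl⟩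
  have hjϖ1 : Valued.v (jE ϖ) ≤ 1 := (hjv ϖ).2 hϖ1
  have hja1 : Valued.v (jE a) ≤ 1 := (hjv a).2 ha
  have hjσa1 : Valued.v (jE (σ a)) ≤ 1 := by rw [← hΘj, hvΘ]; exact hja1
  have hjϖm : Valued.v (jE (ϖ ^ m')) = Valued.v (jE ϖ) ^ m' := by rw [map_pow, map_pow]
  -- the key identity and the three-term split
  have hkey : ∀ η : M, μ / (cc * (α - ρ α) * Θ Y) * (η * Θ η) = hM * Θ (Y⁻¹ * x₀ * η) * (μ * (Y⁻¹ * x₀ * η)) := fun η =>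
    depthCoeff_mul_norm_eq (ρ := ρ) hΘΘ hcc hh hx₀ μ η
  have hsplit := zetaPart_eq (Θ := Θ) hY0 hM x₀ μ ζ (jE a)
  -- the member `y = x₀ζ ∈ Λ`
  have hyΛ : x₀ * ζ ∈ Λ := (hΛ _).2 ⟨ζ, hζ, rfl⟩
  -- (i) `Tr_ρ(hΘy·μy)` with `μy = jE(ϖ^{m′})·Y⁻¹x₀(Y μ̃ ζ)`
  have h1 : Valued.v (hM * Θ (x₀ * ζ) * (μ * (x₀ * ζ)) + ρ (hM * Θ (x₀ * ζ) * (μ * (x₀ * ζ)))) ≤ Valued.v (jE ϖ) ^ m' := by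
    have hz : IsOrd ρ α cc (Y * (μt * ζ)) := isOrd_mul hvρ hYO (isOrd_mul hvρ hμt hζ)
    have e1 : hM * Θ (x₀ * ζ) * (μ * (x₀ * ζ)) = jE (ϖ ^ m') * (hM * Θ (x₀ * ζ) * (Y⁻¹ * (x₀ * (Y * (μt * ζ))))) := by
      rw [hμ]; field_simp
    rw [e1, trace_mul_fixed (hρj _), map_mul, hjϖm]
    exact mul_le_of_le_one_right' (v_trace_herm_le_one_of_isOrd hρρ hvρ hα hα1 hint hΘΘ hΘρ hvΘ hc hc0 hc1 hh hx₀ hΛ hζ hz)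
  -- (ii) `Tr_ρ(hΘy·μw)`, `w = jE a·Y⁻¹x₀`: `μw = jE(ϖ^{m′}·a)·Y⁻¹x₀μ̃`
  have h2 : Valued.v (hM * Θ (x₀ * ζ) * (μ * (Y⁻¹ * (x₀ * jE a))) + ρ (hM * Θ (x₀ * ζ) * (μ * (Y⁻¹ * (x₀ * jE a))))) ≤ Valued.v (jE ϖ) ^ m' := by
    have e1 : hM * Θ (x₀ * ζ) * (μ * (Y⁻¹ * (x₀ * jE a))) = jE (ϖ ^ m' * a) * (hM * Θ (x₀ * ζ) * (Y⁻¹ * (x₀ * μt))) := by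
      rw [hμ, map_mul jE]; ring
    rw [e1, trace_mul_fixed (hρj _), map_mul, map_mul jE, map_mul, hjϖm]
    calc Valued.v (jE ϖ) ^ m' * Valued.v (jE a) * _ ≤ Valued.v (jE ϖ) ^ m' * 1 * 1 := by
          gcongr
          exact v_trace_herm_le_one_of_isOrd hρρ hvρ hα hα1 hint hΘΘ hΘρ hvΘ hc hc0 hc1 hh hx₀ hΛ hζ hμt
      _ = Valued.v (jE ϖ) ^ m' := by rw [mul_one, mul_one]
  -- (iii) `Tr_ρ(hΘw·μy)` = `jE(σa)·jE(ϖ^{m′})·Θ(Tr_ρ(hΘ(x₀ μ̃ζ)·(Y⁻¹x₀·1)))`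
  have h3 : Valued.v (hM * Θ (Y⁻¹ * (x₀ * jE a)) * (μ * (x₀ * ζ)) + ρ (hM * Θ (Y⁻¹ * (x₀ * jE a)) * (μ * (x₀ * ζ)))) ≤ Valued.v (jE ϖ) ^ m' := by
    have hz : IsOrd ρ α cc (μt * ζ) := isOrd_mul hvρ hμt hζ
    have e1 : hM * Θ (Y⁻¹ * (x₀ * jE a)) * (μ * (x₀ * ζ)) = (jE (σ a) * jE (ϖ ^ m')) * (hM * Θ (Y⁻¹ * (x₀ * 1)) * (x₀ * (μt * ζ))) := by
      rw [hμ, map_mul Θ Y⁻¹, map_mul Θ x₀, hΘj, map_mul Θ Y⁻¹, map_mul Θ x₀, map_one]; ring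
    have hρC : ρ (jE (σ a) * jE (ϖ ^ m')) = jE (σ a) * jE (ϖ ^ m') := by rw [map_mul, hρj, hρj]
    rw [e1, trace_mul_fixed hρC, herm_swap_eq hΘΘ hΘρ hΘh, map_mul, map_mul, hvΘ, hjϖm]
    calc Valued.v (jE (σ a)) * Valued.v (jE ϖ) ^ m' * _ ≤ 1 * Valued.v (jE ϖ) ^ m' * 1 := by
          gcongr
          exact v_trace_herm_le_one_of_isOrd hρρ hvρ hα hα1 hint hΘΘ hΘρ hvΘ hc hc0 hc1 hh hx₀ hΛ hz (isOrd_one cc)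
      _ = Valued.v (jE ϖ) ^ m' := by rw [one_mul, mul_one]
  -- assemble: the difference of the two traces is the sum of the three pairings
  have hdiff : (μ / (cc * (α - ρ α) * Θ Y) * ((Y * ζ + jE a) * Θ (Y * ζ + jE a)) + ρ (μ / (cc * (α - ρ α) * Θ Y) * ((Y * ζ + jE a) * Θ (Y * ζ + jE a)))) -
      (μ / (cc * (α - ρ α) * Θ Y) * ((Y * 0 + jE a) * Θ (Y * 0 + jE a)) + ρ (μ / (cc * (α - ρ α) * Θ Y) * ((Y * 0 + jE a) * Θ (Y * 0 + jE a)))) =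
      (hM * Θ (x₀ * ζ) * (μ * (x₀ * ζ)) + ρ (hM * Θ (x₀ * ζ) * (μ * (x₀ * ζ)))) +
        (hM * Θ (x₀ * ζ) * (μ * (Y⁻¹ * (x₀ * jE a))) + ρ (hM * Θ (x₀ * ζ) * (μ * (Y⁻¹ * (x₀ * jE a))))) +
        (hM * Θ (Y⁻¹ * (x₀ * jE a)) * (μ * (x₀ * ζ)) + ρ (hM * Θ (Y⁻¹ * (x₀ * jE a)) * (μ * (x₀ * ζ)))) := by
    rw [hkey, hkey]
    have e : ∀ P Q : M, (P + ρ P) - (Q + ρ Q) = (P - Q) + ρ (P - Q) := fun P Q => by rw [map_sub]; ring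
    rw [e, hsplit, map_add, map_add]
    ring
  rw [hdiff, map_mul, map_inv₀, map_pow]
  have hmm' : Valued.v (jE ϖ) ^ m' ≤ Valued.v (jE ϖ) ^ m := pow_le_pow_right_of_le_one' hjϖ1 hmm
  have hD := (Valuation.map_add Valued.v _ _).trans (max_le ((Valuation.map_add Valued.v _ _).trans (max_le (h1.trans hmm') (h2.trans hmm'))) (h3.trans hmm'))
  by_cases hz : Valued.v (jE ϖ) ^ m = 0
  · rw [hz, inv_zero, zero_mul]; exact zero_le
  · rw [inv_mul_le_iff₀ (zero_lt_iff.2 hz), mul_one]; exact hD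

/-- **HEAD — «NEAR 1 THE LETTER IS THE RAY».**  Under the frame of `hsmall_of_isOrd` (integral cell member `Y ∈ 𝒪_cc`, deep depth multiplier `μ = jE(ϖ^{m′})·μ̃`, `μ̃ ∈ 𝒪_cc`,
`m ≤ m′`) plus the ray letters of ★ p861454 (`σ` isometric, `|ϖ| = exp(−1)`, `|ϖ − σϖ| = |ϖ|^d`, `jE e₀ = Tr_ρ(c_Λ)`): the norm-form letter of ★ p861372 HEAD B EQUALS
`valueSetMod σ ϖ m ((e₀·t₊⁻¹) • X₊)` — so by ★ p861454 §4 the label of the vertex is the norm class of `e₀∕t₊`. [cite: Rogawski1990, §4.9 Prop. 4.9.1 (b) p. 55] [cite: Jacobowitz1962, §4] -/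
theorem normFormSet_eq_ray_of_isOrd (hρρ : ∀ x, ρ (ρ x) = x) (hvρ : ∀ x, Valued.v (ρ x) = Valued.v x) (hα : ρ α ≠ α) (hα1 : Valued.v α ≤ 1)
    (hint : ∀ z : M, Valued.v z ≤ 1 → Valued.v ((z - ρ z) / (α - ρ α)) ≤ 1)
    (hΘΘ : ∀ x, Θ (Θ x) = x) (hΘρ : ∀ x, Θ (ρ x) = ρ (Θ x)) (hvΘ : ∀ x, Valued.v (Θ x) = Valued.v x)
    {cc : M} (hc : ρ cc = cc) (hc0 : cc ≠ 0) (hc1 : Valued.v cc ≤ 1) (hcc : cc * (α - ρ α) ≠ 0) {hM : M} (hh : hM ≠ 0) (hΘh : Θ hM = hM)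
    {Λ : AddSubgroup M} {x₀ : M} (hx₀ : x₀ ≠ 0) (hΛ : ∀ x, x ∈ Λ ↔ ∃ z, IsOrd ρ α cc z ∧ x = x₀ * z)
    (hYO : IsOrd ρ α cc (dualGen ρ Θ α cc hM x₀))
    {σ : E →+* E} (hvσ : ∀ a, Valued.v (σ a) = Valued.v a) {ϖ : E} (hϖ : Valued.v ϖ = exp (-1 : ℤ)) {d : ℕ} (hd : Valued.v (ϖ - σ ϖ) = Valued.v ϖ ^ d)
    (jE : E →+* M) (hjv : ∀ c, Valued.v (jE c) ≤ 1 ↔ Valued.v c ≤ 1) (hΘj : ∀ x, Θ (jE x) = jE (σ x)) (hjfix : ∀ z, ρ z = z ↔ ∃ c, jE c = z)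
    {μ μt : M} {m m' : ℕ} (hμ : μ = jE (ϖ ^ m') * μt) (hμt : IsOrd ρ α cc μt) (hmm : m ≤ m')
    {e₀ : E} (he₀ : jE e₀ = μ / (cc * (α - ρ α) * Θ (dualGen ρ Θ α cc hM x₀)) + ρ (μ / (cc * (α - ρ α) * Θ (dualGen ρ Θ α cc hM x₀)))) :
    {z : E | ∃ (ζ : M) (a : E), IsOrd ρ α cc ζ ∧ Valued.v a ≤ 1 ∧
        Valued.v ((jE ϖ ^ m)⁻¹ * (jE z -
          (μ / (cc * (α - ρ α) * Θ (dualGen ρ Θ α cc hM x₀)) * ((dualGen ρ Θ α cc hM x₀ * ζ + jE a) * Θ (dualGen ρ Θ α cc hM x₀ * ζ + jE a)) +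
            ρ (μ / (cc * (α - ρ α) * Θ (dualGen ρ Θ α cc hM x₀)) * ((dualGen ρ Θ α cc hM x₀ * ζ + jE a) * Θ (dualGen ρ Θ α cc hM x₀ * ζ + jE a)))))) ≤ 1} =
      valueSetMod σ ϖ m ((e₀ * ((ϖ - σ ϖ) * ((ϖ * σ ϖ) ^ ((d - d % 2) / 2))⁻¹)⁻¹) • xPlus σ ϖ d) := by
  have hϖ1 : Valued.v ϖ ≤ 1 := by rw [hϖ, ← exp_zero, exp_le_exp]; norm_num
  exact normFormSet_eq_ray_of_small (ρ := ρ) (α := α) σ hvσ hϖ hd jE hjv hΘj hjfix cc _ _ he₀ m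
    (hsmall_of_isOrd hρρ hvρ hα hα1 hint hΘΘ hΘρ hvΘ hc hc0 hc1 hcc hh hΘh hx₀ hΛ hYO jE hjv hΘj hjfix hϖ1 hμ hμt hmm)

end Summit.HodgeConjecture.HodgeConjecture.Cruxes.H413.F0P3cDyRamNormFormRayDominated

end
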